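import Literature.NumberTheory.Transcendental.ZudilinSaddle
import Literature.NumberTheory.Transcendental.ZudilinHalfLine
import Literature.NumberTheory.Transcendental.ZudilinAmplitude
import Mathlib.MeasureTheory.Integral.IntegralEqImproper
import Mathlib.MeasureTheory.Measure.Haar.NormedSpace
import HarnessLib

/-!
# Zudilin's linear forms along the descent line `re k = ⌊x₀ n⌋ + ½`

Topic `Literature/NumberTheory/Transcendental`; continues `ZudilinHalfLine.lean` (the half-line
Barnes integral `Sₙ = −π² Im ∫_{y>0} Rₙ(m+½+iy) sinh(πy)/cosh³(πy) dy`), `ZudilinAmplitude.lean`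
and `ZudilinSaddle.lean` (the saddle point `κ₀ = x₀ + iu₀`). It DEFINES the objects of the
saddle-point analysis of [Zudilin2004, §8 Lemma 20] on the line through the saddle:

* `Zudilin2004.mLine n = ⌊x₀ n⌋`, `Zudilin2004.xLine n = (⌊x₀ n⌋ + ½)/n` (so `|xLine n − x₀| ≤ 1/(2n)`,
  `e^{2πi n xLine n} = −1`);
* `Zudilin2004.linePhase u = Φ(x₀ + i max(u, 1/10))` — the phase of the Laplace method on the
  line (`linePhase u₀ = Φ(κ₀)`, continuous);
* `Zudilin2004.kerK y = sinh(πy)/cosh³(πy)` (as a complex number);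
* `Zudilin2004.Gfun n u = n⁷ Rₙ(n(xLine n + iu)) kerK(nu)` — the integrand after `y = nu`;

and proves

* `Zudilin2004.S_eq_Gfun` — `Sₙ = −π² Im (n⁻⁶ ∫_{u>0} Gfun n u du)`;
* `Zudilin2004.Gfun_eq` — for `u > 0`,
  `Gfun n u = −Eₙ(κ) e^{A(κ)} k(nu) e^{nΦ(κ)}`, `κ = xLine n + iu`, where
  `Eₙ(κ) = Rₙ(nκ) n⁷ e^{−(nψ(κ)+A(κ))} → 1` (`ZudilinAmplitude.lean`) and
  `k(y) = e^{2πy} sinh(πy)/cosh³(πy) → 4`;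
* `Zudilin2004.norm_R_vline_le` — the elementary comparison down a vertical line,
  `‖Rₙ(c + iy)‖ ≤ ‖Rₙ(c + iy₁)‖ exp((240n+10) y₁²/(2c²))` for `|y| ≤ y₁`, `c > 0`
  (numerator factors grow with `|y|`, denominator factors by at most `(1 + y₁²/c²)^{1/2}` each).

No named fact is introduced.

## References

* [Zudilin2004] W. Zudilin, J. Théor. Nombres Bordeaux 16 (2004), §8, (8.4)–(8.7), Lemma 20.
* [Zudilin2002] W. Zudilin, Izv. Math. 66 (2002), §4, Lemmas 3–6.
-/

noncomputable section

open Complex Finset Filter MeasureTheory Set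
open scoped Real Topology

namespace Literature.NumberTheory.Transcendental

namespace Zudilin2004

/-! ### The line of integration -/

/-- `m_n = ⌊x₀ n⌋`: the integral for `Sₙ` is taken along `re k = m_n + ½`.
[cite: Zudilin2004, §8 Lemma 20] -/
def mLine (n : ℕ) : ℕ := ⌊x0 * n⌋₊

/-- `x_n = (m_n + ½)/n`, the scaled abscissa of the line (`→ x₀`). [cite: Zudilin2004, §8 Lemma 20] -/
def xLine (n : ℕ) : ℝ := ((mLine n : ℝ) + 1 / 2) / n

/-- `m_n ≤ 27 n` (the line passes through the block of triple zeros `1 ≤ k ≤ 27n`). [folklore] -/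
theorem mLine_le (n : ℕ) : mLine n ≤ 27 * n := by
  unfold mLine
  refine Nat.floor_le_of_le ?_
  push_cast
  nlinarith [x0_bounds.2, (n.cast_nonneg : (0 : ℝ) ≤ n)]

/-- `n · x_n = m_n + ½`. [folklore] -/
theorem natCast_mul_xLine {n : ℕ} (hn : 1 ≤ n) : (n : ℝ) * xLine n = mLine n + 1 / 2 := by
  unfold xLine
  have : (0 : ℝ) < n := by exact_mod_cast hn
  field_simp

/-- `|x_n − x₀| ≤ 1/(2n)`. [folklore] -/
theorem abs_xLine_sub_x0_le {n : ℕ} (hn : 1 ≤ n) : |xLine n - x0| ≤ 1 / (2 * n) := by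
  have hn' : (0 : ℝ) < n := by exact_mod_cast hn
  have h1 : (mLine n : ℝ) ≤ x0 * n := Nat.floor_le (by nlinarith [x0_bounds.1])
  have h2 : x0 * n < mLine n + 1 := Nat.lt_floor_add_one _
  have e : xLine n - x0 = ((mLine n : ℝ) + 1 / 2 - x0 * n) / n := by
    unfold xLine; field_simp
  rw [e, abs_div, abs_of_pos hn']
  have hnum : |(mLine n : ℝ) + 1 / 2 - x0 * n| ≤ 1 / 2 := by
    rw [abs_le]; constructor <;> linarith
  calc |(mLine n : ℝ) + 1 / 2 - x0 * n| / n ≤ (1 / 2) / n := div_le_div_of_nonneg_right hnum hn'.le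
    _ = 1 / (2 * n) := by field_simp

/-- `22 ≤ x_n ≤ 25` for `n ≥ 1`. [folklore] -/
theorem xLine_mem {n : ℕ} (hn : 1 ≤ n) : 22 ≤ xLine n ∧ xLine n ≤ 25 := by
  have h := abs_xLine_sub_x0_le hn
  have hn' : (1 : ℝ) ≤ n := by exact_mod_cast hn
  have h2 : 1 / (2 * (n : ℝ)) ≤ 1 / 2 := by
    rw [div_le_div_iff₀ (by positivity) (by norm_num)]; linarith
  rw [abs_le] at h
  have hx := x0_bounds
  constructor <;> linarith [h.1, h.2]

/-- `x_n → x₀`. [folklore] -/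
theorem tendsto_xLine : Tendsto xLine atTop (𝓝 x0) := by
  have h2 : Tendsto (fun n : ℕ ↦ 2 * (n : ℝ)) atTop atTop :=
    (tendsto_natCast_atTop_atTop (R := ℝ)).const_mul_atTop (by norm_num)
  have h : Tendsto (fun n : ℕ ↦ (1 : ℝ) / (2 * (n : ℝ))) atTop (𝓝 0) :=
    tendsto_const_nhds.div_atTop h2
  have h0 : Tendsto (fun n : ℕ ↦ xLine n - x0) atTop (𝓝 0) := by
    refine squeeze_zero_norm' ?_ h
    filter_upwards [eventually_ge_atTop 1] with n hn
    rw [Real.norm_eq_abs]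
    exact abs_xLine_sub_x0_le hn
  simpa using h0.add_const x0

/-- **`e^{2πi n x_n} = −1`** (`n x_n = m_n + ½` is a half-integer). [cite: Zudilin2004, §8 Lemma 20] -/
theorem cexp_two_pi_I_mul_xLine {n : ℕ} (hn : 1 ≤ n) :
    cexp (2 * π * I * ((n : ℂ) * (xLine n : ℂ))) = -1 := by
  have e : (n : ℂ) * (xLine n : ℂ) = (mLine n : ℂ) + 1 / 2 := by
    have := natCast_mul_xLine hn
    exact_mod_cast congrArg (fun r : ℝ ↦ (r : ℂ)) this |>.trans (by push_cast; ring)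
  rw [e, mul_add, Complex.exp_add]
  rw [show 2 * (π : ℂ) * I * (mLine n : ℂ) = (mLine n : ℕ) * (2 * π * I) by ring,
    Complex.exp_nat_mul_two_pi_mul_I, one_mul,
    show 2 * (π : ℂ) * I * (1 / 2) = π * I by ring, Complex.exp_pi_mul_I]

/-! ### The phase along the descent line -/

/-- **The descent-line phase** `P(u) = Φ(x₀ + i max(u, 1/10))`: the total phase on the vertical
line through the saddle, frozen below height `1/10` (where the integrand is handled by a crude
bound instead). `P(u₀) = Φ(κ₀)`. [cite: Zudilin2004, §8 Lemma 20] -/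
def linePhase (u : ℝ) : ℂ := phase ((x0 : ℂ) + (max u (1 / 10) : ℝ) * I)

/-- `P(u) = Φ(x₀ + iu)` for `u ≥ 1/10`. [folklore] -/
theorem linePhase_eq {u : ℝ} (hu : 1 / 10 ≤ u) : linePhase u = phase ((x0 : ℂ) + u * I) := by
  rw [linePhase, max_eq_left hu]

/-- `P(u) = Φ(x₀ + i/10)` for `u ≤ 1/10`. [folklore] -/
theorem linePhase_eq_of_le {u : ℝ} (hu : u ≤ 1 / 10) : linePhase u = phase ((x0 : ℂ) + (1 / 10 : ℝ) * I) := by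
  rw [linePhase, max_eq_right hu]

/-- `P(u₀) = Φ(κ₀)`. [folklore] -/
theorem linePhase_u0 : linePhase u0 = phase saddle := by
  rw [linePhase_eq (by linarith [u0_bounds.1]), x0_add_u0_I]

/-- `P` is continuous. [folklore] -/
theorem continuous_linePhase : Continuous linePhase := by
  have hline : Continuous fun u : ℝ ↦ (x0 : ℂ) + (max u (1 / 10) : ℝ) * I := by fun_prop
  have hmem : ∀ u : ℝ, (x0 : ℂ) + (max u (1 / 10) : ℝ) * I ∈ {κ : ℂ | 0 < κ.im} := fun u ↦ by
    simp only [Set.mem_setOf_eq, add_im, ofReal_im, mul_im, ofReal_re, I_im, mul_one, I_re,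
      mul_zero, add_zero, zero_add]
    exact lt_of_lt_of_le (by norm_num) (le_max_right u (1 / 10))
  have hcont : ContinuousOn phase {κ : ℂ | 0 < κ.im} := fun κ hκ ↦
    (hasDerivAt_phase hκ).continuousAt.continuousWithinAt
  exact hcont.comp_continuous hline hmem

/-! ### The kernel -/

/-- The kernel `K(y) = sinh(πy)/cosh³(πy)` of the Barnes integral, as a complex number.
[cite: Zudilin2004, §8 (8.6)] -/
def kerK (y : ℝ) : ℂ := (Real.sinh (π * y) : ℂ) / (Real.cosh (π * y) : ℂ) ^ 3

/-- `K(y)` is real. [folklore] -/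
theorem kerK_eq_ofReal (y : ℝ) : kerK y = ((Real.sinh (π * y) / Real.cosh (π * y) ^ 3 : ℝ) : ℂ) := by
  unfold kerK; push_cast; rfl

/-- `‖K(y)‖ ≤ 4 e^{−2πy}` for `y ≥ 0`. [folklore] -/
theorem norm_kerK_le {y : ℝ} (hy : 0 ≤ y) : ‖kerK y‖ ≤ 4 * Real.exp (-(2 * π * y)) := by
  rw [kerK_eq_ofReal, Complex.norm_real, Real.norm_eq_abs,
    abs_of_nonneg (sinh_div_cosh_cube_nonneg (by positivity))]
  have := sinh_div_cosh_cube_le (y := π * y) (by positivity)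
  rw [show -(2 * π * y) = -2 * (π * y) by ring]
  exact this

/-- `‖K(y)‖ ≤ 4` for `y ≥ 0`. [folklore] -/
theorem norm_kerK_le_four {y : ℝ} (hy : 0 ≤ y) : ‖kerK y‖ ≤ 4 := by
  refine (norm_kerK_le hy).trans ?_
  have : Real.exp (-(2 * π * y)) ≤ 1 := by
    rw [Real.exp_le_one_iff]; have := Real.pi_pos; nlinarith
  linarith

/-- `K` is continuous. [folklore] -/
theorem continuous_kerK : Continuous kerK := by
  unfold kerK
  refine Continuous.div (by fun_prop) (by fun_prop) fun y ↦ ?_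
  exact pow_ne_zero 3 (by exact_mod_cast (Real.cosh_pos _).ne')

/-- `K(y) = k(y) e^{−2πy}` with `k(y) = e^{2πy} K(y)` (which tends to `4`). [folklore] -/
theorem kerK_eq_mul_cexp (y : ℝ) :
    kerK y = ((Real.sinh (π * y) / Real.cosh (π * y) ^ 3 * Real.exp (2 * (π * y)) : ℝ) : ℂ) *
      cexp (-(2 * π * y : ℝ)) := by
  rw [kerK_eq_ofReal, ← Complex.ofReal_neg, ← Complex.ofReal_exp, ← Complex.ofReal_mul]
  congr 1
  rw [mul_assoc, ← Real.exp_add, show 2 * (π * y) + -(2 * π * y) = 0 by ring, Real.exp_zero, mul_one]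

/-! ### The scaled integrand -/

/-- **`G_n(u) = n⁷ Rₙ(n(x_n + iu)) K(nu)`**, the integrand of the half-line Barnes integral after
the substitution `y = nu`. [cite: Zudilin2004, §8 Lemma 20] -/
def Gfun (n : ℕ) (u : ℝ) : ℂ := (n : ℂ) ^ 7 * R n ((n : ℂ) * ((xLine n : ℂ) + u * I)) * kerK (n * u)

/-- The point `n(x_n + iu) = (m_n + ½) + i(nu)` on the line. [folklore] -/
theorem natCast_mul_line {n : ℕ} (hn : 1 ≤ n) (u : ℝ) :
    (n : ℂ) * ((xLine n : ℂ) + u * I) = ((mLine n : ℝ) + 1 / 2 : ℝ) + ((n : ℝ) * u : ℝ) * I := by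
  have e : ((n : ℝ) * xLine n : ℝ) = ((mLine n : ℝ) + 1 / 2 : ℝ) := natCast_mul_xLine hn
  rw [← e]; push_cast; ring

/-- `G_n` is continuous (`n ≥ 1`; the line `re k = m_n + ½ > 0` avoids the poles). [folklore] -/
theorem continuous_Gfun {n : ℕ} (hn : 1 ≤ n) : Continuous (Gfun n) := by
  unfold Gfun
  refine (continuous_const.mul ?_).mul (continuous_kerK.comp (by fun_prop))
  have hline : Continuous fun u : ℝ ↦ (n : ℂ) * ((xLine n : ℂ) + u * I) := by fun_prop
  have hmem : ∀ u : ℝ, (n : ℂ) * ((xLine n : ℂ) + u * I) ∈ {k : ℂ | -1 / 2 < k.re} := fun u ↦ by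
    rw [natCast_mul_line hn]
    simp only [Set.mem_setOf_eq, add_re, ofReal_re, mul_re, I_re, mul_zero, ofReal_im, I_im,
      mul_one, sub_self, add_zero]
    have : (0 : ℝ) ≤ mLine n := Nat.cast_nonneg _
    linarith
  exact (differentiableOn_R hn).continuousOn.comp_continuous hline hmem

/-- `G_n` is integrable (`n ≥ 1`). [folklore] -/
theorem integrable_Gfun {n : ℕ} (hn : 1 ≤ n) : Integrable (Gfun n) := by
  have hn' : (0 : ℝ) < n := by exact_mod_cast hn
  have hc : (0 : ℝ) ≤ (mLine n : ℝ) + 1 / 2 := by positivity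
  have hint := (integrable_R_mul_kernel hn hc).comp_mul_left' hn'.ne'
  refine (hint.const_mul ((n : ℂ) ^ 7)).congr (ae_of_all _ fun u ↦ ?_)
  simp only [Gfun, kerK, natCast_mul_line hn]
  push_cast
  ring

/-- **`Sₙ = −π² Im (n⁻⁶ ∫_{u>0} G_n(u) du)`** (`n ≥ 1`). [cite: Zudilin2004, §8 (8.4)–(8.6), Lemma 20] -/
theorem S_eq_Gfun {n : ℕ} (hn : 1 ≤ n) :
    S n = -π ^ 2 * (((n : ℂ)⁻¹) ^ 6 * ∫ u in Ioi (0 : ℝ), Gfun n u).im := by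
  have hn' : (0 : ℝ) < n := by exact_mod_cast hn
  have hn0 : (n : ℂ) ≠ 0 := by exact_mod_cast hn'.ne'
  rw [S_eq_neg_pi_sq_mul_im hn (mLine_le n)]
  congr 2
  set f : ℝ → ℂ := fun y ↦ R n ((mLine n : ℂ) + 1 / 2 + y * I) *
    ((Real.sinh (π * y) : ℂ) / (Real.cosh (π * y) : ℂ) ^ 3) with hf
  have hsub := integral_comp_mul_left_Ioi f 0 hn'
  rw [mul_zero] at hsub
  have hG : ∀ u : ℝ, f (n * u) = ((n : ℂ) ^ 7)⁻¹ * Gfun n u := by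
    intro u
    simp only [hf, Gfun, kerK, natCast_mul_line hn]
    push_cast
    field_simp
  change ∫ y in Ioi (0 : ℝ), f y = _
  have e : ∫ y in Ioi (0 : ℝ), f y = (n : ℂ) * ∫ u in Ioi (0 : ℝ), f (n * u) := by
    rw [hsub, Complex.real_smul]
    push_cast
    field_simp
  rw [e]
  simp_rw [hG]
  rw [integral_const_mul]
  field_simp

/-! ### The structure of `G_n` above the real axis -/

/-- **`G_n(u) = −Eₙ(κ) · e^{A(κ)} · k(nu) · e^{nΦ(κ)}`** for `u > 0`, `κ = x_n + iu`, with
`Eₙ(κ) = Rₙ(nκ) n⁷ e^{−(nψ(κ) + A(κ))}` and `k(y) = e^{2πy} sinh(πy)/cosh³(πy)`: the total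
phase `Φ = ψ + 2πiκ` absorbs the kernel, the sign being `e^{2πi n x_n} = −1`.
[cite: Zudilin2004, §8 Lemma 20] -/
theorem Gfun_eq {n : ℕ} (hn : 1 ≤ n) (u : ℝ) :
    Gfun n u = -(R n ((n : ℂ) * ((xLine n : ℂ) + u * I)) * (n : ℂ) ^ 7 *
        cexp (-((n : ℂ) * psiR ((xLine n : ℂ) + u * I) + amp ((xLine n : ℂ) + u * I)))) *
      cexp (amp ((xLine n : ℂ) + u * I)) *
      ((Real.sinh (π * (n * u)) / Real.cosh (π * (n * u)) ^ 3 * Real.exp (2 * (π * (n * u))) : ℝ) : ℂ) *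
      cexp ((n : ℂ) * phase ((xLine n : ℂ) + u * I)) := by
  set κ : ℂ := (xLine n : ℂ) + u * I with hκ
  set kk : ℝ := Real.sinh (π * (n * u)) / Real.cosh (π * (n * u)) ^ 3 * Real.exp (2 * (π * (n * u)))
  -- the phase: `e^{nΦ(κ)} = e^{nψ(κ)} · e^{2πi n x_n} · e^{−2πnu} = −e^{nψ(κ)} e^{−2πnu}`
  have hphase : cexp ((n : ℂ) * phase κ) = -(cexp ((n : ℂ) * psiR κ) * cexp (-(2 * π * (n * u) : ℝ))) := by
    have e1 : (n : ℂ) * phase κ = (n : ℂ) * psiR κ + 2 * π * I * ((n : ℂ) * (xLine n : ℂ)) +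
        (-(2 * π * (n * u) : ℝ) : ℂ) := by
      rw [hκ]; unfold phase; push_cast
      have : I * I = -1 := Complex.I_mul_I
      linear_combination (2 * (π : ℂ) * (n : ℂ) * (u : ℂ)) * this
    rw [e1, Complex.exp_add, Complex.exp_add, cexp_two_pi_I_mul_xLine hn]
    ring
  have hk : kerK (n * u) = (kk : ℂ) * cexp (-(2 * π * (n * u) : ℝ)) := kerK_eq_mul_cexp (n * u)
  have hcancel : cexp (-((n : ℂ) * psiR κ + amp κ)) * cexp (amp κ) * cexp ((n : ℂ) * psiR κ) = 1 := by
    rw [← Complex.exp_add, ← Complex.exp_add, ← Complex.exp_zero]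
    congr 1; ring
  unfold Gfun
  rw [hphase, hk]
  linear_combination (-(R n ((n : ℂ) * κ) * (n : ℂ) ^ 7 * (kk : ℂ) *
    cexp (-(2 * π * (n * u) : ℝ)))) * hcancel

/-! ### Comparison down a vertical line -/

/-- `‖a + iy‖ ≤ ‖a + iy₁‖` for real `a` and `|y| ≤ y₁`. [folklore] -/
theorem norm_ofReal_add_mul_I_le (a : ℝ) {y y₁ : ℝ} (h : |y| ≤ y₁) :
    ‖(a : ℂ) + y * I‖ ≤ ‖(a : ℂ) + y₁ * I‖ := by
  have hy1 : 0 ≤ y₁ := (abs_nonneg y).trans h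
  refine le_of_sq_le_sq ?_ (norm_nonneg _)
  rw [Complex.sq_norm, Complex.sq_norm, Complex.normSq_add_mul_I, Complex.normSq_add_mul_I]
  have : y ^ 2 ≤ y₁ ^ 2 := by rw [← sq_abs y]; exact pow_le_pow_left₀ (abs_nonneg y) h 2
  linarith

/-- `‖a + iy₁‖ ≤ ‖a + iy‖ · exp(y₁²/(2c²))` for real `a ≥ c > 0` and any `y`. [folklore] -/
theorem norm_ofReal_add_mul_I_le_mul_exp {a c y₁ : ℝ} (hc : 0 < c) (ha : c ≤ a) (y : ℝ) :
    ‖(a : ℂ) + y₁ * I‖ ≤ ‖(a : ℂ) + y * I‖ * Real.exp (y₁ ^ 2 / (2 * c ^ 2)) := by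
  have hpos : 0 < ‖(a : ℂ) + y * I‖ := by
    refine norm_pos_iff.2 fun h0 ↦ ?_
    have := congrArg Complex.re h0
    simp at this; linarith
  refine le_of_sq_le_sq ?_ (by positivity)
  rw [mul_pow, Complex.sq_norm, Complex.sq_norm, Complex.normSq_add_mul_I, Complex.normSq_add_mul_I,
    ← Real.exp_nat_mul]
  have h1 : 1 + y₁ ^ 2 / c ^ 2 ≤ Real.exp ((2 : ℕ) * (y₁ ^ 2 / (2 * c ^ 2))) := by
    have e2 : ((2 : ℕ) : ℝ) * (y₁ ^ 2 / (2 * c ^ 2)) = y₁ ^ 2 / c ^ 2 := by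
      push_cast; field_simp
    rw [e2]
    linarith [Real.add_one_le_exp (y₁ ^ 2 / c ^ 2)]
  have h2 : a ^ 2 + y₁ ^ 2 ≤ (a ^ 2 + y ^ 2) * (1 + y₁ ^ 2 / c ^ 2) := by
    have hca : c ^ 2 ≤ a ^ 2 := pow_le_pow_left₀ hc.le ha 2
    have : y₁ ^ 2 ≤ (a ^ 2 + y ^ 2) * (y₁ ^ 2 / c ^ 2) := by
      rw [mul_div_assoc', le_div_iff₀ (by positivity)]
      nlinarith [sq_nonneg y, sq_nonneg y₁]
    nlinarith
  exact h2.trans (mul_le_mul_of_nonneg_left h1 (by positivity))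

/-- **Comparison down a vertical line.** For `n ≥ 1`, `c > 0` and `|y| ≤ y₁`,
`‖Rₙ(c + iy)‖ ≤ ‖Rₙ(c + iy₁)‖ · exp((240n+10) y₁²/(2c²))`: the numerator factors `k − i`,
`k + i`, `37n + 2k` only grow in modulus with `|im k|`, and each of the `240n + 10` denominator
factors `k + i` (`i ≥ 0`) grows by at most `exp(y₁²/(2c²))`. [cite: Zudilin2004, §8 (8.7)] -/
theorem norm_R_vline_le (n : ℕ) {c y y₁ : ℝ} (hc : 0 < c) (hy : |y| ≤ y₁) :
    ‖R n ((c : ℂ) + y * I)‖ ≤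
      ‖R n ((c : ℂ) + y₁ * I)‖ * Real.exp ((240 * n + 10) * y₁ ^ 2 / (2 * c ^ 2)) := by
  set k : ℂ := (c : ℂ) + y * I with hk
  set k₁ : ℂ := (c : ℂ) + y₁ * I with hk₁
  set e : ℝ := Real.exp (y₁ ^ 2 / (2 * c ^ 2)) with he
  have he1 : 1 ≤ e := Real.one_le_exp (by positivity)
  -- numerator factors
  have hlin : ∀ a : ℝ, ‖(a : ℂ) + k - c‖ ≤ ‖(a : ℂ) + k₁ - c‖ := fun a ↦ by
    have e1 : (a : ℂ) + k - c = (a : ℂ) + y * I := by rw [hk]; ring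
    have e2 : (a : ℂ) + k₁ - c = (a : ℂ) + y₁ * I := by rw [hk₁]; ring
    rw [e1, e2]; exact norm_ofReal_add_mul_I_le a hy
  have hsub : ∀ i : ℕ, ‖k - i‖ ≤ ‖k₁ - i‖ := fun i ↦ by
    have := hlin (c - i); push_cast at this
    convert this using 2 <;> ring
  have hadd : ∀ i : ℕ, ‖k + i‖ ≤ ‖k₁ + i‖ := fun i ↦ by
    have := hlin (c + i); push_cast at this
    convert this using 2 <;> ring
  have hw : ‖(37 * n + 2 * k : ℂ)‖ ≤ ‖(37 * n + 2 * k₁ : ℂ)‖ := by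
    have h2 : |2 * y| ≤ 2 * y₁ := by rw [abs_mul, abs_two]; linarith
    have := norm_ofReal_add_mul_I_le (37 * n + 2 * c) h2
    push_cast at this
    convert this using 2 <;> [rw [hk]; rw [hk₁]] <;> ring
  -- denominator factors
  have hden : ∀ i : ℕ, ‖k₁ + i‖ ≤ ‖k + i‖ * e := fun i ↦ by
    have := norm_ofReal_add_mul_I_le_mul_exp (a := c + i) (y₁ := y₁) hc
      (by linarith [(i.cast_nonneg : (0 : ℝ) ≤ i)]) y
    push_cast at this
    convert this using 2 <;> [rw [hk₁]; (congr 1; rw [hk])] <;> ring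
  have hden_pos : ∀ i : ℕ, 0 < ‖k + i‖ := fun i ↦ by
    refine norm_pos_iff.2 fun h0 ↦ ?_
    have := congrArg Complex.re h0
    rw [hk] at this; simp at this; linarith [(i.cast_nonneg : (0 : ℝ) ≤ i)]
  have hden1_pos : ∀ i : ℕ, 0 < ‖k₁ + i‖ := fun i ↦ by
    refine norm_pos_iff.2 fun h0 ↦ ?_
    have := congrArg Complex.re h0
    rw [hk₁] at this; simp at this; linarith [(i.cast_nonneg : (0 : ℝ) ≤ i)]
  -- products
  have hN1 : ‖(∏ i ∈ Icc 1 (27 * n), (k - i)) ^ 3‖ ≤ ‖(∏ i ∈ Icc 1 (27 * n), (k₁ - i)) ^ 3‖ := by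
    rw [norm_pow, norm_pow, norm_prod, norm_prod]
    exact pow_le_pow_left₀ (by positivity)
      (prod_le_prod (fun i _ ↦ norm_nonneg _) fun i _ ↦ hsub i) 3
  have hN2 : ‖(∏ i ∈ Icc (37 * n + 1) (64 * n), (k + i)) ^ 3‖ ≤
      ‖(∏ i ∈ Icc (37 * n + 1) (64 * n), (k₁ + i)) ^ 3‖ := by
    rw [norm_pow, norm_pow, norm_prod, norm_prod]
    exact pow_le_pow_left₀ (by positivity)
      (prod_le_prod (fun i _ ↦ norm_nonneg _) fun i _ ↦ hadd i) 3
  have hD : ‖∏ u ∈ Icc 1 10, ∏ i ∈ Icc ((12 - u) * n) ((25 + u) * n), (k₁ + i)‖ ≤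
      ‖∏ u ∈ Icc 1 10, ∏ i ∈ Icc ((12 - u) * n) ((25 + u) * n), (k + i)‖ * e ^ (240 * n + 10) := by
    rw [norm_prod, norm_prod, ← sum_card_blocks n, ← prod_pow_eq_pow_sum, ← prod_mul_distrib]
    refine prod_le_prod (fun u _ ↦ by positivity) fun u _ ↦ ?_
    rw [norm_prod, norm_prod, ← prod_const, ← prod_mul_distrib]
    exact prod_le_prod (fun i _ ↦ norm_nonneg _) fun i _ ↦ hden i
  have hDpos : 0 < ‖∏ u ∈ Icc 1 10, ∏ i ∈ Icc ((12 - u) * n) ((25 + u) * n), (k + i)‖ := by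
    rw [norm_prod]; exact prod_pos fun u _ ↦ by rw [norm_prod]; exact prod_pos fun i _ ↦ hden_pos i
  have hD1pos : 0 < ‖∏ u ∈ Icc 1 10, ∏ i ∈ Icc ((12 - u) * n) ((25 + u) * n), (k₁ + i)‖ := by
    rw [norm_prod]; exact prod_pos fun u _ ↦ by rw [norm_prod]; exact prod_pos fun i _ ↦ hden1_pos i
  -- assemble
  have hexp : e ^ (240 * n + 10) = Real.exp ((240 * n + 10) * y₁ ^ 2 / (2 * c ^ 2)) := by
    rw [he, ← Real.exp_nat_mul]; push_cast; ring_nf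
  have hNum : ‖(normConst n : ℂ) * (37 * n + 2 * k) * (∏ i ∈ Icc 1 (27 * n), (k - i)) ^ 3 *
      (∏ i ∈ Icc (37 * n + 1) (64 * n), (k + i)) ^ 3‖ ≤
      ‖(normConst n : ℂ) * (37 * n + 2 * k₁) * (∏ i ∈ Icc 1 (27 * n), (k₁ - i)) ^ 3 *
      (∏ i ∈ Icc (37 * n + 1) (64 * n), (k₁ + i)) ^ 3‖ := by
    simp only [norm_mul]
    gcongr
  set D := ‖∏ u ∈ Icc 1 10, ∏ i ∈ Icc ((12 - u) * n) ((25 + u) * n), (k + (i : ℂ))‖ with hDdef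
  set D₁ := ‖∏ u ∈ Icc 1 10, ∏ i ∈ Icc ((12 - u) * n) ((25 + u) * n), (k₁ + (i : ℂ))‖ with hD₁def
  have key : 1 / D ≤ e ^ (240 * n + 10) / D₁ := by
    rw [div_le_div_iff₀ hDpos hD1pos, one_mul, mul_comm]
    exact hD
  unfold R
  rw [norm_div, norm_div, ← hexp]
  calc _ ≤ ‖(normConst n : ℂ) * (37 * n + 2 * k₁) * (∏ i ∈ Icc 1 (27 * n), (k₁ - i)) ^ 3 *
        (∏ i ∈ Icc (37 * n + 1) (64 * n), (k₁ + i)) ^ 3‖ / D :=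
          div_le_div_of_nonneg_right hNum hDpos.le
    _ = ‖(normConst n : ℂ) * (37 * n + 2 * k₁) * (∏ i ∈ Icc 1 (27 * n), (k₁ - i)) ^ 3 *
        (∏ i ∈ Icc (37 * n + 1) (64 * n), (k₁ + i)) ^ 3‖ * (1 / D) := by ring
    _ ≤ ‖(normConst n : ℂ) * (37 * n + 2 * k₁) * (∏ i ∈ Icc 1 (27 * n), (k₁ - i)) ^ 3 *
        (∏ i ∈ Icc (37 * n + 1) (64 * n), (k₁ + i)) ^ 3‖ * (e ^ (240 * n + 10) / D₁) :=
          mul_le_mul_of_nonneg_left key (norm_nonneg _)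
    _ = _ := by ring

end Zudilin2004

end Literature.NumberTheory.Transcendental
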